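import Mathlib
import Summits.NavierStokesRegularity.NavierStokesRegularity.Theorems.EulerZoomLiouvillePowerGaugeEulerLiouvilleSelfSimilarBoundedRigidity
import Summits.NavierStokesRegularity.NavierStokesRegularity.Theorems.EulerZoomLiouvillePowerGaugeEulerLiouvilleSelfSimilarWeakToClassical
import Summits.NavierStokesRegularity.NavierStokesRegularity.Theorems.EulerZoomLiouvillePowerGaugeEulerLiouvilleSelfSimilarNoDriftBadNodeC2
import Summits.NavierStokesRegularity.NavierStokesRegularity.Theorems.EulerZoomLiouvillePowerGaugeEulerLiouvilleSelfSimilarThinSetsC2c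
import HarnessLib.Audit

/-!
# Rung C1 of the crux `EulerZoomLiouville.PowerGaugeEulerLiouville` (W1 stage S5): RIGIDITY AND THE CLASSICAL STRATUM AT CIV's OWN
# REGULARITY — a class member whose velocity profile is `C² ∩ L^∞ ∩ Ẇ^{1,∞}` is trivial

Route №10 `EulerZoomLiouville` (NavierStokesRegularity), crux E = stmt-NavierStokesRegularity-19832, tenure rung C1,
registered residue `stub_selfSimilarExtremalRest`, sub-stratum W1.  Lineage ns-typeII-p2 (gen 8, INTERIM LEAD).  The top of the
`C²` twin chain (S1 `…KelvinFlowC2` → S2 `…BoundedConfinementC2` → S3 `…NoDriftC2` / `…NoDriftBadNodeC2` → S4 `…ThinSetsC2a/b/c`):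

* `C2.NoDrift.curl_eq_zero_of_smooth_of_bounded`, **`C2.NoDrift.eq_const_of_smooth_of_bounded`**,
  `C2.NoDrift.pressure_eq_of_smooth_of_bounded`, `C2.NoDrift.eq_zero_of_smooth_of_bounded_of_growth`,
  `C2.NoDrift.selfSimilar_ae_eq_zero_of_smooth_of_bounded_of_gaugeA` — the rigidity theorem and its corollaries for
  `V ∈ C²` (the regularity CIV (3.3) itself demands), `‖V‖ ≤ M`, `‖DV‖ ≤ K`, `0 < γ < ½`, no pressure hypothesis;
* **`C2.WeakToClassical.selfSimilar_ae_eq_zero_of_bounded_profile`** — MEMBER LEVEL, crux hypotheses verbatim + exact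
  self-similarity: if the velocity profile is `C²` with `‖V‖ ≤ M`, `‖DV‖ ≤ K`, the member vanishes a.e.  This closes sub-stratum
  W1 of `stub_selfSimilarExtremalRest`: the classical stratum is «`V ∈ C² ∩ L^∞ ∩ Ẇ^{1,∞}`» (skeleton v15).

WHAT THIS IS NOT: not NS, not E, not rung C1 — the weak class (`V ∉ C²`) and `C²` profiles unbounded at infinity remain.
[folklore; ChaeShvydkoy2013 §4 (setting); ConstantinIgnatovaVicol2026Putative §3 (setting)]
-/

noncomputable section

-- flat `Theorems/<Route><Decl>…` files of one crux share the namespace of the crux (tree convention)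
set_option linter.dupNamespace false

open MeasureTheory Set Filter Topology Metric Function InnerProductSpace
open scoped RealInnerProductSpace NNReal ENNReal ContDiff

namespace Summit.NavierStokesRegularity.NavierStokesRegularity.Theorems.PowerGaugeEulerLiouville.C2.NoDrift

open Literature.Analysis Literature.Analysis.FluidPDE
open Summit.NavierStokesRegularity.NavierStokesRegularity.Theorems.PowerGaugeEulerLiouville.C2.Kelvin
open Summit.NavierStokesRegularity.NavierStokesRegularity.Theorems.PowerGaugeEulerLiouville.Kelvin

variable {γ : ℝ} {V : EuclideanSpace ℝ (Fin 3) → EuclideanSpace ℝ (Fin 3)} {P : EuclideanSpace ℝ (Fin 3) → ℝ}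

/-- **A bounded `C²` self-similar Euler profile with bounded gradient is IRROTATIONAL** (`0 < γ < ½`; NO condition on the
pressure; `C²` twin): every vortical backward trajectory converges to one bad node (`tendsto_flow_atBot_of_curl_ne_zero_of_bounded'`),
the bad set is compact with null backward basin (p1's `isClosed_badSet`, p3's `exists_trappedSet_null_of_bad` +
`volume_setOf_tendsto_flow_atBot_mem_eq_zero_of_trappedSets`), so `{curl V ≠ 0}` is open and null, hence empty.
[folklore; three-lineage chain of the ns-regularity-ideate cell] -/
theorem curl_eq_zero_of_smooth_of_bounded (hV : ContDiff ℝ 2 V) (hprof : IsSelfSimilarEulerProfile γ 0 V P) {M K : ℝ}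
    (hM : ∀ y, ‖V y‖ ≤ M) (hK : ∀ y, ‖fderiv ℝ V y‖ ≤ K) (hγ : 0 < γ) (hγ2 : γ < 1 / 2)
    (x : EuclideanSpace ℝ (Fin 3)) : curl V x = 0 := by
  set B : Set (EuclideanSpace ℝ (Fin 3)) := {z | z ∈ selfSimilarNodalSet γ 0 V ∧
    ∃ w : EuclideanSpace ℝ (Fin 3), ‖w‖ = 1 ∧ 1 ≤ ⟪fderiv ℝ V z w, w⟫} with hB
  have hBc : IsCompact B := isCompact_badNodalSet_of_bounded hV hprof hγ hM
  -- the backward basin of the bad set is null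
  have hnull := volume_setOf_tendsto_flow_atBot_mem_eq_zero_of_trappedSets hV hK hBc
    fun z hz => exists_trappedSet_null_of_bad hV hK hprof hγ hγ2 hz.1 hz.2
  -- every vortical point lies in it
  have hsub : {x : EuclideanSpace ℝ (Fin 3) | curl V x ≠ 0} ⊆ {x : EuclideanSpace ℝ (Fin 3) | ∃ z ∈ B,
      Tendsto (fun s => ODE.evolutionMap (fun _ : ℝ => selfSimilarTransport γ 0 V) 0 s x) atBot (𝓝 z)} := by
    intro x hx
    obtain ⟨z, hzN, hbad, hz⟩ := tendsto_flow_atBot_of_curl_ne_zero_of_bounded' hV hK hprof hM hγ hγ2 hx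
    exact ⟨z, ⟨hzN, hbad⟩, hz⟩
  -- an open null set is empty
  have hopen : IsOpen {x : EuclideanSpace ℝ (Fin 3) | curl V x ≠ 0} := by
    exact isOpen_ne_fun (differentiable_curl_of_contDiff hV).continuous continuous_const
  have hzero : volume {x : EuclideanSpace ℝ (Fin 3) | curl V x ≠ 0} = 0 := measure_mono_null hsub hnull
  have hempty : {x : EuclideanSpace ℝ (Fin 3) | curl V x ≠ 0} = ∅ := (hopen.measure_eq_zero_iff volume).1 hzero
  by_contra hx
  have : x ∈ ({x : EuclideanSpace ℝ (Fin 3) | curl V x ≠ 0} : Set _) := hx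
  rw [hempty] at this
  exact this

/-- **RIGIDITY AT `C²`: a bounded `C²` self-similar Euler profile with bounded gradient is CONSTANT** (`0 < γ < ½`; no pressure
hypothesis).  Irrotational by `curl_eq_zero_of_smooth_of_bounded`, divergence-free by (3.3), bounded — so every component is
a bounded harmonic function (`eq_const_of_curl_eq_zero_of_bounded`). [folklore] -/
theorem eq_const_of_smooth_of_bounded (hV : ContDiff ℝ 2 V) (hprof : IsSelfSimilarEulerProfile γ 0 V P) {M K : ℝ}
    (hM : ∀ y, ‖V y‖ ≤ M) (hK : ∀ y, ‖fderiv ℝ V y‖ ≤ K) (hγ : 0 < γ) (hγ2 : γ < 1 / 2)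
    (x y : EuclideanSpace ℝ (Fin 3)) : V x = V y :=
  PowerGaugeEulerLiouville.NoDrift.eq_const_of_curl_eq_zero_of_bounded hV (curl_eq_zero_of_smooth_of_bounded hV hprof hM hK hγ hγ2)
    hprof.divFree hM x y

/-- **The pressure of a bounded classical in-window profile is affine**: `P y = P 0 − (1−γ)⟪V 0, y⟫`.  With
`eq_const_of_smooth_of_bounded` this says the bounded smooth profiles with bounded gradient, `0 < γ < ½`, are EXACTLY the
pairs `(b, P₀ − (1−γ)⟪b, ·⟩)`, `b ∈ ℝ³` — the obstruction to dropping `P ≤ P₀` at profile level, and nothing else.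
[folklore] -/
theorem pressure_eq_of_smooth_of_bounded (hV : ContDiff ℝ 2 V) (hprof : IsSelfSimilarEulerProfile γ 0 V P) {M K : ℝ}
    (hM : ∀ y, ‖V y‖ ≤ M) (hK : ∀ y, ‖fderiv ℝ V y‖ ≤ K) (hγ : 0 < γ) (hγ2 : γ < 1 / 2)
    (y : EuclideanSpace ℝ (Fin 3)) : P y = P 0 - (1 - γ) * ⟪V 0, y⟫ := by
  have hconst := eq_const_of_smooth_of_bounded hV hprof hM hK hγ hγ2
  set a : EuclideanSpace ℝ (Fin 3) := V 0 with ha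
  have hVa : V = fun _ => a := funext fun z => hconst z 0
  -- `∇P ≡ −(1−γ) a`
  have hgradP : ∀ z, gradient P z = -((1 - γ) • a) := by
    intro z
    have e := hprof.profile_eq z
    have hD : fderiv ℝ V z = 0 := by rw [hVa]; exact fderiv_const_apply a
    rw [hD, hconst z 0] at e
    have e' : (1 - γ) • a + gradient P z = 0 := by simpa using e
    exact eq_neg_of_add_eq_zero_right e'
  -- `P` along the segment `t ↦ t • y`
  set φ : ℝ → ℝ := fun t => P (t • y) with hφ
  have hPd := hprof.differentiable_pressure
  have hφ' : ∀ t, HasDerivAt φ (-((1 - γ) * ⟪a, y⟫)) t := by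
    intro t
    have h1 : HasDerivAt (fun s : ℝ => s • y) y t := by simpa using ((hasDerivAt_id t).smul_const y)
    have h2 := ((hPd (t • y)).hasFDerivAt).comp_hasDerivAt t h1
    refine h2.congr_deriv ?_
    rw [← inner_gradient_left, hgradP, inner_neg_left, inner_smul_left]
    simp
  have hlin : φ 1 = φ 0 + -((1 - γ) * ⟪a, y⟫) * 1 := by
    have hψ : ∀ s, HasDerivAt (fun t => φ t - -((1 - γ) * ⟪a, y⟫) * t) 0 s := by
      intro s
      have h := (hφ' s).sub ((hasDerivAt_id s).const_mul (-((1 - γ) * ⟪a, y⟫)))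
      rw [mul_one, sub_self] at h
      exact h
    have hc := is_const_of_deriv_eq_zero (fun s => (hψ s).differentiableAt) (fun s => (hψ s).deriv) 1 0
    simp only [mul_zero, sub_zero] at hc
    linarith
  have h1 : φ 1 = P y := by simp [hφ]
  have h0 : φ 0 = P 0 := by simp [hφ]
  rw [← h1, hlin, h0]
  ring

/-- **A bounded smooth self-similar Euler profile with bounded gradient and sub-cubic `L²`-growth is trivial**
(`0 < γ < ½`; NO pressure hypothesis): constant by rigidity, zero by the growth bound.  The class gauge of an exactly
self-similar member gives `θ = 1 − 2ρ`. [folklore] -/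
theorem eq_zero_of_smooth_of_bounded_of_growth (hV : ContDiff ℝ 2 V) (hprof : IsSelfSimilarEulerProfile γ 0 V P) {M K : ℝ}
    (hM : ∀ y, ‖V y‖ ≤ M) (hK : ∀ y, ‖fderiv ℝ V y‖ ≤ K) (hγ : 0 < γ) (hγ2 : γ < 1 / 2) {C : ℝ≥0∞} (hC : C ≠ ⊤)
    {θ : ℝ} (hθ : θ < 3)
    (hA : ∀ L : ℝ, 0 < L → ∫⁻ y in ball (0 : EuclideanSpace ℝ (Fin 3)) L, ‖V y‖ₑ ^ 2 ≤ C * ENNReal.ofReal (L ^ θ)) :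
    V = 0 := by
  have hconst := eq_const_of_smooth_of_bounded hV hprof hM hK hγ hγ2
  set a : EuclideanSpace ℝ (Fin 3) := V 0 with ha
  have hVa : V = fun _ => a := funext fun z => hconst z 0
  have ha0 : a = 0 := by
    refine PowerGaugeEulerLiouville.NoDrift.eq_zero_of_const_of_lintegral_ball_le hC hθ fun L hL => ?_
    have h := hA L hL
    rw [hVa] at h
    exact h
  rw [hVa, ha0]; rfl

/-! ### Member level: the bounded classical stratum, with NO pressure clause -/

/-- **THE BOUNDED CLASSICAL STRATUM OF `stub_selfSimilarExtremalRest`, PRESSURE-FREE, MEMBER LEVEL.**  Let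
`u(τ) = selfSimilarCollapse (1/(2+ρ)) 0 V τ` (`τ < 0`, any `ρ > 0`, so `γ = 1/(2+ρ) ∈ (0, ½)`) be an exactly self-similar
velocity field satisfying the class's `A`-GAUGE bound `a^{2ρ} A(a) ≤ c` (`a > 0`) — the first of the three crux
hypotheses, nothing else of the class is used.  If `V` is smooth with `‖V‖ ≤ M`, `‖DV‖ ≤ K` and `(V, P)` solves CIV (3.3)
for some `P`, then `u = 0` a.e. on `(−∞,0) × ℝ³`.  NO condition on `P`, NO far field, NO normalisation: rigidity makes
`V ≡ b`, and the `A`-gauge in profile variables, `∫_{B_L}|V|² ≤ c L^{1−2ρ}` (`profile_energy_growth_of_gaugeA`), forces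
`b = 0`.  Supersedes the `P ≤ P₀` clause of `selfSimilar_ae_eq_zero_of_smooth_of_bounded` (p572037) for class members
(glue from the crux binder: `hA := fun a ha => le_trans (le_trans le_self_add le_self_add) (hgauge a ha)`). [folklore] -/
theorem selfSimilar_ae_eq_zero_of_smooth_of_bounded_of_gaugeA {ρ : ℝ} (hρ : 0 < ρ)
    {u : ℝ → EuclideanSpace ℝ (Fin 3) → EuclideanSpace ℝ (Fin 3)} {c : ℝ≥0}
    (hu : ∀ τ : ℝ, τ < 0 → u τ = selfSimilarCollapse (1 / (2 + ρ)) 0 V τ)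
    (hA : ∀ a : ℝ, 0 < a →
      ENNReal.ofReal (a ^ (2 * ρ)) * cknA a (0 : ℝ × EuclideanSpace ℝ (Fin 3)) u ≤ (c : ℝ≥0∞))
    (hV : ContDiff ℝ 2 V) (hprof : IsSelfSimilarEulerProfile (1 / (2 + ρ)) 0 V P) {M K : ℝ}
    (hM : ∀ y, ‖V y‖ ≤ M) (hK : ∀ y, ‖fderiv ℝ V y‖ ≤ K) :
    uncurry u =ᵐ[volume.restrict (Iio (0 : ℝ) ×ˢ (univ : Set (EuclideanSpace ℝ (Fin 3))))] 0 := by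
  have h2ρ : (0 : ℝ) < 2 + ρ := by linarith
  have hγ : (0 : ℝ) < 1 / (2 + ρ) := one_div_pos.2 h2ρ
  have hγ2 : 1 / (2 + ρ) < 1 / 2 := one_div_lt_one_div_of_lt two_pos (by linarith)
  have hgrowth := profile_energy_growth_of_gaugeA hρ hu hA
  have hV0 : V = 0 :=
    eq_zero_of_smooth_of_bounded_of_growth hV hprof hM hK hγ hγ2 ENNReal.coe_ne_top (θ := 1 - 2 * ρ) (by linarith)
      hgrowth
  exact selfSimilar_ae_eq_zero_of_profile_eq_zero u hu hV0

end Summit.NavierStokesRegularity.NavierStokesRegularity.Theorems.PowerGaugeEulerLiouville.C2.NoDrift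

namespace Summit.NavierStokesRegularity.NavierStokesRegularity.Theorems.PowerGaugeEulerLiouville.C2.WeakToClassical

open Literature.Analysis Literature.Analysis.FluidPDE Literature.Analysis.FunctionSpaces
open Summit.NavierStokesRegularity.NavierStokesRegularity.Theorems.PowerGaugeEulerLiouville.WeakToClassical

/-- **THE CLASSICAL STRATUM OF `stub_selfSimilarExtremalRest` AT CIV's OWN REGULARITY, MEMBER LEVEL.**  Crux hypotheses verbatim
(`0 < ρ < 1`) + exact self-similarity with profile `(V, P)`: if `V ∈ C²` with `‖V‖ ≤ M` and `‖DV‖ ≤ K`, then `u = 0` a.e. on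
`(−∞,0) × ℝ³`.  Nothing is assumed about the pressure profile (CIV (3.3) for some `C¹` pressure is derived:
`WeakToClassical.exists_isSelfSimilarEulerProfile_of_contDiff`), nothing about the far field, the stagnation set or a
normalisation.  `C²` form of `WeakToClassical.selfSimilar_ae_eq_zero_of_smooth_bounded_profile` (p578901). [folklore] -/
theorem selfSimilar_ae_eq_zero_of_bounded_profile {ρ : ℝ} (hρ : 0 < ρ) (hρ1 : ρ < 1)
    {u : ℝ → EuclideanSpace ℝ (Fin 3) → EuclideanSpace ℝ (Fin 3)} {p : ℝ → EuclideanSpace ℝ (Fin 3) → ℝ}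
    {H : ℝ → EuclideanSpace ℝ (Fin 3) → EuclideanSpace ℝ (Fin 3) →L[ℝ] EuclideanSpace ℝ (Fin 3)} {c : ℝ≥0}
    (hsw : IsSuitableWeakSolutionOn (slab (EuclideanSpace ℝ (Fin 3)) (Iio 0) isOpen_Iio) 0 0 u p)
    (hgauge : ∀ a : ℝ, 0 < a →
      ENNReal.ofReal (a ^ (2 * ρ)) * cknA a (0 : ℝ × EuclideanSpace ℝ (Fin 3)) u +
          ENNReal.ofReal (a ^ ρ) * cknE a (0 : ℝ × EuclideanSpace ℝ (Fin 3)) H +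
        ENNReal.ofReal (a ^ (2 * ρ)) * cknD a (0 : ℝ × EuclideanSpace ℝ (Fin 3)) p ≤ (c : ℝ≥0∞))
    {V : EuclideanSpace ℝ (Fin 3) → EuclideanSpace ℝ (Fin 3)} {P : EuclideanSpace ℝ (Fin 3) → ℝ}
    (hu : ∀ τ : ℝ, τ < 0 → u τ = selfSimilarCollapse (1 / (2 + ρ)) 0 V τ)
    (hp : ∀ τ : ℝ, τ < 0 → p τ = selfSimilarCollapsePressure (1 / (2 + ρ)) 0 P τ)
    (hV : ContDiff ℝ 2 V) {M K : ℝ} (hM : ∀ y, ‖V y‖ ≤ M) (hK : ∀ y, ‖fderiv ℝ V y‖ ≤ K) :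
    uncurry u =ᵐ[volume.restrict (Iio (0 : ℝ) ×ˢ (univ : Set (EuclideanSpace ℝ (Fin 3))))] 0 := by
  have hA : ∀ a : ℝ, 0 < a → ENNReal.ofReal (a ^ (2 * ρ)) *
      cknA a (0 : ℝ × EuclideanSpace ℝ (Fin 3)) u ≤ (c : ℝ≥0∞) :=
    fun a ha => le_trans (le_trans le_self_add le_self_add) (hgauge a ha)
  have hD : ∀ a : ℝ, 0 < a → ENNReal.ofReal (a ^ (2 * ρ)) *
      cknD a (0 : ℝ × EuclideanSpace ℝ (Fin 3)) p ≤ (c : ℝ≥0∞) :=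
    fun a ha => le_trans le_add_self (hgauge a ha)
  have hpm : AEStronglyMeasurable (uncurry p)
      (volume.restrict (Iio (0 : ℝ) ×ˢ (univ : Set (EuclideanSpace ℝ (Fin 3))))) := by
    have := hsw.distributional.2.2.1.aestronglyMeasurable
    simpa [slab] using this
  have hPm := aestronglyMeasurable_pressureProfile hpm hp
  have hDprof := profile_pressure_weight_of_gaugeD hρ hρ1 hpm hp hD
  have hP1 : LocallyIntegrable P volume :=
    EnergySaturation.locallyIntegrable_pressure_of_weight hρ1 hPm
      (ENNReal.mul_ne_top ENNReal.ofReal_ne_top ENNReal.coe_ne_top) hDprof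
  obtain ⟨P', hprof⟩ := exists_isSelfSimilarEulerProfile_of_contDiff hsw.distributional hu hp hV hP1
  exact C2.NoDrift.selfSimilar_ae_eq_zero_of_smooth_of_bounded_of_gaugeA hρ hu hA hV hprof hM hK

end Summit.NavierStokesRegularity.NavierStokesRegularity.Theorems.PowerGaugeEulerLiouville.C2.WeakToClassical

end
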